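import Literature.Geometry.Lorentzian.DevelopmentGluingCauchy
import Literature.Geometry.Lorentzian.MaximalCommonDevelopment
import Literature.Geometry.Lorentzian.HypersurfaceNaturality
import Literature.Geometry.Lorentzian.CurvatureNaturality
import Literature.Geometry.Lorentzian.LorentzianMetricProofs
import HarnessLib

/-!
# The common extension of two globally hyperbolic developments glued along a common development
# without corresponding boundary points (Sbierski 2016, Thm. 5 from Thm. 17)

Final file of the gluing construction of J. Sbierski, Ann. Henri Poincaré 17 (2016) =
arXiv:1309.7591v3, §3.3, proof of Thm. 5 (*"Given two GHDs `M` and `M'` of the same initial data,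
there exists a GHD `M̃` that is an extension of `M` and `M'`"*): the glued spacetime
`(M̃, g̃, T̃)` of a common development `𝔠 = (U, ψ)` of the Cauchy developments `𝒟`, `𝒟'`
(`DevelopmentGluingData`, `DevelopmentGluingMetric`) carries the data embedding
`ι̃ = π j ∘ ι` with future unit normal `d(π j) ν`, inducing the data `(h, k)` (naturality of the
induced metric and of the second fundamental form under the isometric immersion `π j`,
`PseudoRiemannianMetric.secondFundamentalForm_comap`), whose image is a Cauchy hypersurface
(`DevelopmentGluingCauchy`); it is vacuum when `𝒟`, `𝒟'` are (naturality of the Ricci tensor,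
`PseudoRiemannianMetric.ricci_comap_apply`); and `π j`, `π j'` embed `𝒟`, `𝒟'` into it
(*"it is an extension of `M` and `M'`, where the isometric embeddings are given by the maps
`π ∘ j` and `π ∘ j'`"*). Hence:

* `CommonDevelopment.exists_common_extension` — **two Cauchy developments with a common
  development without corresponding boundary points have a common extension** (Sbierski's proof
  of Thm. 5 given the conclusion of Thm. 17, *"the MCGHD does not have corresponding boundary
  points"*, for the common development used); `exists_common_vacuum_extension` for vacuum
  developments;
* `CauchyDevelopment.CommonDevelopment.ofIsCommonDevelopment` — the datum of a common development
  from the `Prop`-valued `IsCommonDevelopment` of `MaximalCommonDevelopment` (in particular from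
  the MCGHD, Thm. 10);
* `choquetBruhat_geroch_common_extension_of_localTheory_of_mcghd_noCorrespondingBoundary` —
  **the input `hce` of the Zorn frame** (`CauchyProblemMGHDExistenceProofs`: any two vacuum
  Cauchy developments of the same data have a common extension) **follows from** (i) the
  existence of SOME common development of any two developments (Thm. 4, local existence and
  uniqueness — the PDE input), (ii) Thm. 17 (the MCGHD has no corresponding boundary points —
  whose printed proof, Thm. 12, again uses Thm. 4), and (iii) the differentiability of the future
  unit normal of a development along its data embedding (true for every development; needed by
  the naturality lemma of the second fundamental form and displayed, as in
  `CauchyDevelopmentRestrict`, until it is proved in the tree).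

The hypothesis (iii) is `hν` throughout. No named facts are introduced (D-0026); the three
`def`s (`gluedDataEmbedding`, `gluedCauchyDevelopment`, `gluedVacuumCauchyDevelopment`,
`ofIsCommonDevelopment`) have bodies, everything else is proved.

## References

* J. Sbierski, Ann. Henri Poincaré 17 (2016) 301–329 = arXiv:1309.7591v3, §2 Thm. 5 (= Thm. 2.7
  of the journal version), §3.3 proof of Thm. 5, Thm. 17.
* Y. Choquet-Bruhat, R. Geroch, Comm. Math. Phys. 14 (1969) 329–335, Thm. 3 and its proof,
  pp. 333–334.
* H. Ringström, *The Cauchy Problem in General Relativity*, EMS 2009, Ch. 23.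
* B. O'Neill, *Semi-Riemannian geometry with applications to relativity*, 1983, Ch. 3, pp. 90–91,
  Ch. 4, Lemma 4.4 ff.
-/

noncomputable section

open Bundle Set Function Filter TopologicalSpace Topology Manifold
open scoped Manifold ContDiff Topology
open Literature.Topology.FourManifolds

namespace Literature.Geometry.Lorentzian

universe u

section Developments

variable {n : ℕ} {X : Type u} [TopologicalSpace X] [ChartedSpace (EuclideanSpace ℝ (Fin n)) X]
  [IsManifold (𝓡 n) ∞ X] [ConnectedSpace X] {D : InitialDataSet (𝓡 n) X}

namespace CauchyDevelopment

namespace CommonDevelopment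

variable {𝒟 𝒟' : CauchyDevelopment D} (𝔠 : CommonDevelopment 𝒟 𝒟')

/-! ### The glued data embedding -/

/-- `π j` is differentiable. [folklore] -/
theorem mdifferentiable_inl : MDifferentiable (𝓡 (n + 1)) (𝓡 (n + 1)) 𝔠.inl :=
  𝔠.glueData.contMDiff_inl.mdifferentiable (by simp)

/-- Chain rule for the glued data embedding `ι̃ = π j ∘ ι`. [folklore] -/
theorem mfderiv_inl_comp_embed (x : X) (v : TangentSpace (𝓡 n) x) :
    mfderiv (𝓡 n) (𝓡 (n + 1)) (𝔠.inl ∘ 𝒟.embed) x v =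
      mfderiv (𝓡 (n + 1)) (𝓡 (n + 1)) 𝔠.inl (𝒟.embed x)
        (mfderiv (𝓡 n) (𝓡 (n + 1)) 𝒟.embed x v) := by
  rw [mfderiv_comp x (𝔠.mdifferentiable_inl _) (𝒟.mdifferentiable_embed x)]
  rfl

/-- `π j^* g̃ = g` as an equality of fields of bilinear forms. [cite: Sbierski2016AHP, §3.3, proof of Thm. 5 ("this turns `π ∘ j` … into isometries")] -/
theorem pullbackBilin_inl_gluedMetric :
    pullbackBilin (I := 𝓡 (n + 1)) (I' := 𝓡 (n + 1)) 𝔠.inl 𝔠.gluedMetric.val = 𝒟.metric.val :=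
  funext 𝔠.isIsometricImmersion_inl.2

/-- **The pull-back of the glued metric along `π j` is the metric of `𝒟`**
(`PseudoRiemannianMetric.comap` along the isometric immersion `π j`). [cite: Sbierski2016AHP, §3.3, proof of Thm. 5] -/
theorem comap_gluedMetric_inl :
    𝔠.gluedMetric.toPseudoRiemannianMetric.comap PseudoRiemannianMetric.contMDiff_pullbackBilin_holds
      𝔠.inl 𝔠.glueData.contMDiff_inl (fun a ↦ (𝔠.mfderiv_inl_bijective a).1) rfl =
      𝒟.metric.toPseudoRiemannianMetric :=
  PseudoRiemannianMetric.ext 𝔠.pullbackBilin_inl_gluedMetric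

/-- **The pull-back of the glued metric along `π j'` is the metric of `𝒟'`.** [cite: Sbierski2016AHP, §3.3, proof of Thm. 5] -/
theorem comap_gluedMetric_inr :
    𝔠.gluedMetric.toPseudoRiemannianMetric.comap PseudoRiemannianMetric.contMDiff_pullbackBilin_holds
      𝔠.inr 𝔠.glueData.contMDiff_inr (fun b ↦ (𝔠.mfderiv_inr_bijective b).1) rfl =
      𝒟'.metric.toPseudoRiemannianMetric :=
  PseudoRiemannianMetric.ext (funext 𝔠.isIsometricImmersion_inr.2)

/-- **The glued data embedding** `(M̃, g̃, T̃, ι̃ = π j ∘ ι, ν̃ = d(π j) ν)` of the data `D`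
(Sbierski 2016, §3.3: *"`ι̃ := π ∘ j ∘ ι : M̄ → M̃`"*): a smooth embedding
(`SmoothGlueData.isSmoothEmbedding_inl_comp`), with future unit normal `d(π j) ν` (isometry and
time-orientation preservation of `π j`), inducing `h` (`ι̃^* g̃ = ι^* (π j^* g̃) = ι^* g = h`) and
`k` (naturality of the second fundamental form under the isometric immersion `π j`,
`PseudoRiemannianMetric.secondFundamentalForm_comap`, which requires the differentiability `hν`
of `ν` along `ι`). Hypotheses: `U` has no corresponding boundary points (`M̃` Hausdorff).
[cite: Sbierski2016AHP, §3.3, proof of Thm. 5 ("`(M̃, g̃, ι̃)` is a GHD of `(M̄, ḡ, k̄)`")] -/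
def gluedDataEmbedding (h : ¬ 𝔠.HasCorrespondingBoundaryPoints)
    (hν : ∀ x, MDifferentiableAt (𝓡 n) (𝓡 (n + 1)).tangent
      (fun x ↦ (TotalSpace.mk' (EuclideanSpace ℝ (Fin (n + 1))) (𝒟.embed x) (𝒟.normal x) :
        TangentBundle (𝓡 (n + 1)) 𝒟.carrier)) x) :
    DataEmbedding D where
  toSpacetime := 𝔠.gluedSpacetime h
  embed := 𝔠.inl ∘ 𝒟.embed
  isSmoothEmbedding := 𝔠.glueData.isSmoothEmbedding_inl_comp 𝒟.isSmoothEmbedding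
  normal := fun x ↦ mfderiv (𝓡 (n + 1)) (𝓡 (n + 1)) 𝔠.inl (𝒟.embed x) (𝒟.normal x)
  isFutureUnitNormal := by
    refine ⟨⟨fun y v ↦ ?_, fun y ↦ ?_⟩, fun y ↦ ?_⟩
    · change 𝔠.gluedMetric.val (𝔠.inl (𝒟.embed y))
        (mfderiv (𝓡 (n + 1)) (𝓡 (n + 1)) 𝔠.inl (𝒟.embed y) (𝒟.normal y))
        (mfderiv (𝓡 n) (𝓡 (n + 1)) (𝔠.inl ∘ 𝒟.embed) y v) = 0
      rw [𝔠.mfderiv_inl_comp_embed, 𝔠.val_gluedMetric_inl]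
      exact 𝒟.isFutureUnitNormal.1.1 y v
    · change 𝔠.gluedMetric.val (𝔠.inl (𝒟.embed y))
        (mfderiv (𝓡 (n + 1)) (𝓡 (n + 1)) 𝔠.inl (𝒟.embed y) (𝒟.normal y))
        (mfderiv (𝓡 (n + 1)) (𝓡 (n + 1)) 𝔠.inl (𝒟.embed y) (𝒟.normal y)) = -1
      rw [𝔠.val_gluedMetric_inl]
      exact 𝒟.isFutureUnitNormal.1.2 y
    · exact (𝔠.preservesTimeOrientation_inl h).isFutureDirected_mfderiv
        𝔠.isIsometricImmersion_inl.2 (𝒟.isFutureUnitNormal.2 y)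
  induced_h := fun y ↦ by
    change pullbackBilin (I := 𝓡 (n + 1)) (I' := 𝓡 n) (𝔠.inl ∘ 𝒟.embed) 𝔠.gluedMetric.val y =
      D.h.inner y
    rw [pullbackBilin_comp 𝔠.mdifferentiable_inl 𝒟.mdifferentiable_embed,
      𝔠.pullbackBilin_inl_gluedMetric]
    exact 𝒟.induced_h y
  induced_k := by
    intro inst y
    haveI hLC : 𝒟.metric.toPseudoRiemannianMetric.HasLeviCivita :=
      𝒟.metric.toPseudoRiemannianMetric.hasLeviCivita
    haveI hgcLC : (𝔠.gluedMetric.toPseudoRiemannianMetric.comap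
        PseudoRiemannianMetric.contMDiff_pullbackBilin_holds 𝔠.inl 𝔠.glueData.contMDiff_inl
        (fun a ↦ (𝔠.mfderiv_inl_bijective a).1) rfl).HasLeviCivita :=
      PseudoRiemannianMetric.hasLeviCivita _
    have key := PseudoRiemannianMetric.secondFundamentalForm_comap
      𝔠.gluedMetric.toPseudoRiemannianMetric PseudoRiemannianMetric.contMDiff_pullbackBilin_holds
      (Φ := 𝔠.inl) 𝔠.glueData.contMDiff_inl (fun a ↦ (𝔠.mfderiv_inl_bijective a).1) rfl
      (f := 𝒟.embed) (ν := 𝒟.normal) (y := y) BoundarylessManifold.isInteriorPoint (hν y)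
    change 𝔠.gluedMetric.toPseudoRiemannianMetric.secondFundamentalForm (𝓡 n) (𝔠.inl ∘ 𝒟.embed)
      (fun x ↦ mfderiv (𝓡 (n + 1)) (𝓡 (n + 1)) 𝔠.inl (𝒟.embed x) (𝒟.normal x)) y = D.kBilin y
    rw [← key, PseudoRiemannianMetric.secondFundamentalForm_congr_metric 𝔠.comap_gluedMetric_inl
      hgcLC hLC]
    exact 𝒟.induced_k y

/-- **The glued Cauchy development** of `D`: the glued data embedding, whose data hypersurface
`ι̃(X)` is a Cauchy hypersurface of `(M̃, g̃, T̃)` (`isCauchyHypersurface_glued`). Sbierski 2016,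
§3.3: *"We have thus shown that `(M̃, g̃, ι̃)` is a GHD of `(M̄, ḡ, k̄)`"*.
[cite: Sbierski2016AHP, §3.3, proof of Thm. 5 ("`(M̃, g̃, ι̃)` is a GHD of `(M̄, ḡ, k̄)`")] -/
def gluedCauchyDevelopment (h : ¬ 𝔠.HasCorrespondingBoundaryPoints)
    (hν : ∀ x, MDifferentiableAt (𝓡 n) (𝓡 (n + 1)).tangent
      (fun x ↦ (TotalSpace.mk' (EuclideanSpace ℝ (Fin (n + 1))) (𝒟.embed x) (𝒟.normal x) :
        TangentBundle (𝓡 (n + 1)) 𝒟.carrier)) x) :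
    CauchyDevelopment D where
  toDataEmbedding := 𝔠.gluedDataEmbedding h hν
  isCauchyHypersurface := 𝔠.isCauchyHypersurface_glued h

/-- **`𝒟` embeds into the glued development** via `π j` (Sbierski 2016, §3.3: *"it is an extension
of `M` and `M'`, where the isometric embeddings are given by the maps `π ∘ j` and `π ∘ j'`"*).
[cite: Sbierski2016AHP, §3.3, proof of Thm. 5 ("it is an extension of `M` and `M'`")] -/
theorem embedsInto_glued_left (h : ¬ 𝔠.HasCorrespondingBoundaryPoints)
    (hν : ∀ x, MDifferentiableAt (𝓡 n) (𝓡 (n + 1)).tangent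
      (fun x ↦ (TotalSpace.mk' (EuclideanSpace ℝ (Fin (n + 1))) (𝒟.embed x) (𝒟.normal x) :
        TangentBundle (𝓡 (n + 1)) 𝒟.carrier)) x) :
    𝒟.EmbedsInto (𝔠.gluedCauchyDevelopment h hν) :=
  ⟨𝔠.inl, 𝔠.glueData.contMDiff_inl, 𝔠.glueData.isOpenEmbedding_inl, 𝔠.isIsometricImmersion_inl,
    𝔠.preservesTimeOrientation_inl h, rfl⟩

/-- **`𝒟'` embeds into the glued development** via `π j'` (`π j' ∘ ι' = π j ∘ ι = ι̃`).
[cite: Sbierski2016AHP, §3.3, proof of Thm. 5 ("it is an extension of `M` and `M'`")] -/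
theorem embedsInto_glued_right (h : ¬ 𝔠.HasCorrespondingBoundaryPoints)
    (hν : ∀ x, MDifferentiableAt (𝓡 n) (𝓡 (n + 1)).tangent
      (fun x ↦ (TotalSpace.mk' (EuclideanSpace ℝ (Fin (n + 1))) (𝒟.embed x) (𝒟.normal x) :
        TangentBundle (𝓡 (n + 1)) 𝒟.carrier)) x) :
    𝒟'.EmbedsInto (𝔠.gluedCauchyDevelopment h hν) :=
  ⟨𝔠.inr, 𝔠.glueData.contMDiff_inr, 𝔠.glueData.isOpenEmbedding_inr, 𝔠.isIsometricImmersion_inr,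
    𝔠.preservesTimeOrientation_inr h, funext fun x ↦ (𝔠.inl_embed_eq_inr_embed x).symm⟩

/-- **Sbierski 2016, Theorem 5 (common extension), from a common development without
corresponding boundary points.** If the Cauchy developments `𝒟`, `𝒟'` of `D` have a common
globally hyperbolic development `𝔠 = (U, ψ)` without corresponding boundary points (the
conclusion of Thm. 17 for the MCGHD) — and the future unit normal of `𝒟` is differentiable along
its data embedding — then `𝒟` and `𝒟'` embed into a common Cauchy development of `D`: the gluing
`M ∪_U M'`. [cite: Sbierski2016AHP, §2, Thm. 5 (arXiv numbering) and §3.3, proof of Thm. 5] -/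
theorem exists_common_extension (h : ¬ 𝔠.HasCorrespondingBoundaryPoints)
    (hν : ∀ x, MDifferentiableAt (𝓡 n) (𝓡 (n + 1)).tangent
      (fun x ↦ (TotalSpace.mk' (EuclideanSpace ℝ (Fin (n + 1))) (𝒟.embed x) (𝒟.normal x) :
        TangentBundle (𝓡 (n + 1)) 𝒟.carrier)) x) :
    ∃ 𝒟₃ : CauchyDevelopment.{u} D, 𝒟.EmbedsInto 𝒟₃ ∧ 𝒟'.EmbedsInto 𝒟₃ :=
  ⟨𝔠.gluedCauchyDevelopment h hν, 𝔠.embedsInto_glued_left h hν, 𝔠.embedsInto_glued_right h hν⟩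

/-! ### Vacuum -/

/-- **The glued metric is Ricci flat when `g` and `g'` are** (naturality of the Ricci tensor
under the local isometries `π j`, `π j'`, `PseudoRiemannianMetric.ricci_comap_apply`, whose
differentials are onto). Sbierski 2016, §3.3: *"this yields a smooth Lorentzian Ricci-flat metric
`g̃` on `M̃`"*. [cite: Sbierski2016AHP, §3.3, proof of Thm. 5 ("Ricci-flat metric `g̃` on `M̃`")] -/
theorem isRicciFlat_gluedMetric (h₁ : 𝒟.toDataEmbedding.IsVacuum) (h₂ : 𝒟'.toDataEmbedding.IsVacuum)
    [𝔠.gluedMetric.toPseudoRiemannianMetric.HasLeviCivita] :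
    𝔠.gluedMetric.toPseudoRiemannianMetric.IsRicciFlat := by
  intro p
  haveI hLC : 𝒟.metric.toPseudoRiemannianMetric.HasLeviCivita :=
    𝒟.metric.toPseudoRiemannianMetric.hasLeviCivita
  haveI hLC' : 𝒟'.metric.toPseudoRiemannianMetric.HasLeviCivita :=
    𝒟'.metric.toPseudoRiemannianMetric.hasLeviCivita
  obtain (⟨a, rfl⟩ | ⟨b, rfl⟩) := 𝔠.glueData.exists_inl_or_inr p
  · set gc := 𝔠.gluedMetric.toPseudoRiemannianMetric.comap
      PseudoRiemannianMetric.contMDiff_pullbackBilin_holds 𝔠.inl 𝔠.glueData.contMDiff_inl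
      (fun a ↦ (𝔠.mfderiv_inl_bijective a).1) rfl with hgc_def
    haveI hgcLC : gc.HasLeviCivita := gc.hasLeviCivita
    have hgc : gc = 𝒟.metric.toPseudoRiemannianMetric := 𝔠.comap_gluedMetric_inl
    refine LinearMap.ext fun V ↦ LinearMap.ext fun W ↦ ?_
    obtain ⟨Y₀, rfl⟩ := (𝔠.mfderiv_inl_bijective a).2 V
    obtain ⟨Z₀, rfl⟩ := (𝔠.mfderiv_inl_bijective a).2 W
    have key := PseudoRiemannianMetric.ricci_comap_apply 𝔠.gluedMetric.toPseudoRiemannianMetric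
      PseudoRiemannianMetric.contMDiff_pullbackBilin_holds (Φ := 𝔠.inl) 𝔠.glueData.contMDiff_inl
      (fun a ↦ (𝔠.mfderiv_inl_bijective a).1) rfl a Y₀ Z₀
    change 𝔠.gluedMetric.toPseudoRiemannianMetric.ricci (𝔠.inl a)
      (mfderiv (𝓡 (n + 1)) (𝓡 (n + 1)) 𝔠.inl a Y₀) (mfderiv (𝓡 (n + 1)) (𝓡 (n + 1)) 𝔠.inl a Z₀) = 0
    rw [← key, PseudoRiemannianMetric.ricci_congr_metric hgc hgcLC hLC, h₁ a]
    rfl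
  · set gc := 𝔠.gluedMetric.toPseudoRiemannianMetric.comap
      PseudoRiemannianMetric.contMDiff_pullbackBilin_holds 𝔠.inr 𝔠.glueData.contMDiff_inr
      (fun b ↦ (𝔠.mfderiv_inr_bijective b).1) rfl with hgc_def
    haveI hgcLC : gc.HasLeviCivita := gc.hasLeviCivita
    have hgc : gc = 𝒟'.metric.toPseudoRiemannianMetric := 𝔠.comap_gluedMetric_inr
    refine LinearMap.ext fun V ↦ LinearMap.ext fun W ↦ ?_
    obtain ⟨Y₀, rfl⟩ := (𝔠.mfderiv_inr_bijective b).2 V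
    obtain ⟨Z₀, rfl⟩ := (𝔠.mfderiv_inr_bijective b).2 W
    have key := PseudoRiemannianMetric.ricci_comap_apply 𝔠.gluedMetric.toPseudoRiemannianMetric
      PseudoRiemannianMetric.contMDiff_pullbackBilin_holds (Φ := 𝔠.inr) 𝔠.glueData.contMDiff_inr
      (fun b ↦ (𝔠.mfderiv_inr_bijective b).1) rfl b Y₀ Z₀
    change 𝔠.gluedMetric.toPseudoRiemannianMetric.ricci (𝔠.inr b)
      (mfderiv (𝓡 (n + 1)) (𝓡 (n + 1)) 𝔠.inr b Y₀) (mfderiv (𝓡 (n + 1)) (𝓡 (n + 1)) 𝔠.inr b Z₀) = 0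
    rw [← key, PseudoRiemannianMetric.ricci_congr_metric hgc hgcLC hLC', h₂ b]
    rfl

end CommonDevelopment

end CauchyDevelopment

/-! ### Vacuum developments -/

namespace VacuumCauchyDevelopment

/-- **The glued vacuum Cauchy development** of two vacuum Cauchy developments along a common
development without corresponding boundary points. [cite: Sbierski2016AHP, §3.3, proof of Thm. 5] -/
def gluedVacuumCauchyDevelopment (𝒟 𝒟' : VacuumCauchyDevelopment D)
    (𝔠 : CauchyDevelopment.CommonDevelopment 𝒟.toCauchyDevelopment 𝒟'.toCauchyDevelopment)
    (h : ¬ 𝔠.HasCorrespondingBoundaryPoints)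
    (hν : ∀ x, MDifferentiableAt (𝓡 n) (𝓡 (n + 1)).tangent
      (fun x ↦ (TotalSpace.mk' (EuclideanSpace ℝ (Fin (n + 1))) (𝒟.embed x) (𝒟.normal x) :
        TangentBundle (𝓡 (n + 1)) 𝒟.carrier)) x) :
    VacuumCauchyDevelopment D where
  toCauchyDevelopment := 𝔠.gluedCauchyDevelopment h hν
  isRicciFlat := by
    intro inst
    haveI : 𝔠.gluedMetric.toPseudoRiemannianMetric.HasLeviCivita := inst
    exact 𝔠.isRicciFlat_gluedMetric 𝒟.isVacuum 𝒟'.isVacuum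

/-- **Sbierski 2016, Theorem 5 for vacuum developments, from a common development without
corresponding boundary points**: two vacuum Cauchy developments of `D` with a common globally
hyperbolic development without corresponding boundary points (and the future unit normal of the
first differentiable along its data embedding) embed into a common vacuum Cauchy development of
`D`. [cite: Sbierski2016AHP, §2, Thm. 5 (arXiv numbering) and §3.3, proof of Thm. 5] -/
theorem exists_common_extension (𝒟 𝒟' : VacuumCauchyDevelopment D)
    (𝔠 : CauchyDevelopment.CommonDevelopment 𝒟.toCauchyDevelopment 𝒟'.toCauchyDevelopment)
    (h : ¬ 𝔠.HasCorrespondingBoundaryPoints)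
    (hν : ∀ x, MDifferentiableAt (𝓡 n) (𝓡 (n + 1)).tangent
      (fun x ↦ (TotalSpace.mk' (EuclideanSpace ℝ (Fin (n + 1))) (𝒟.embed x) (𝒟.normal x) :
        TangentBundle (𝓡 (n + 1)) 𝒟.carrier)) x) :
    ∃ 𝒟₃ : VacuumCauchyDevelopment.{u} D,
      𝒟.toCauchyDevelopment.EmbedsInto 𝒟₃.toCauchyDevelopment ∧
        𝒟'.toCauchyDevelopment.EmbedsInto 𝒟₃.toCauchyDevelopment :=
  ⟨gluedVacuumCauchyDevelopment 𝒟 𝒟' 𝔠 h hν, 𝔠.embedsInto_glued_left h hν,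
    𝔠.embedsInto_glued_right h hν⟩

end VacuumCauchyDevelopment

/-! ### From the MCGHD: the input `hce` of the Zorn frame -/

namespace CauchyDevelopment

/-- **The datum of a common development from the `Prop`-valued `IsCommonDevelopment`** (a
choice of its isometric immersion; in particular the MCGHD `mcghd 𝒟 𝒟'` of Thm. 10 with its
glued immersion gives such a datum when some common development exists).
[cite: Sbierski2016AHP, §2, Def. 2.4 and §3.1, Thm. 10 (arXiv numbering)] -/
def CommonDevelopment.ofIsCommonDevelopment {𝒟 𝒟' : CauchyDevelopment D} {U : Opens 𝒟.carrier}
    (hU : 𝒟.IsCommonDevelopment 𝒟'.toDataEmbedding U) : CommonDevelopment 𝒟 𝒟' where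
  opens := U
  embed_mem := hU.embed_mem
  isCauchyHypersurface := hU.isCauchyHypersurface
  map := hU.exists_isIsometricImmersion.choose
  isIsometricImmersion := hU.exists_isIsometricImmersion.choose_spec.1
  preservesTimeOrientation := hU.exists_isIsometricImmersion.choose_spec.2.1
  map_comp_embedOpens := hU.exists_isIsometricImmersion.choose_spec.2.2

/-- The open set of the datum is the given common development. [folklore] -/
@[simp]
theorem CommonDevelopment.ofIsCommonDevelopment_opens {𝒟 𝒟' : CauchyDevelopment D}
    {U : Opens 𝒟.carrier} (hU : 𝒟.IsCommonDevelopment 𝒟'.toDataEmbedding U) :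
    (CommonDevelopment.ofIsCommonDevelopment hU).opens = U := rfl

end CauchyDevelopment

/-- **The common-extension input `hce` of the Zorn frame of Choquet-Bruhat–Geroch's Theorem 3
(`VacuumCauchyDevelopment.exists_isMaximal_of_chains_bounded_of_common_extension`,
`CauchyProblemMGHDExistenceProofs`) from the local theory and Sbierski's Theorem 17.** Suppose,
for the vacuum Cauchy developments of a data set `D`: (i) any two of them have SOME common
globally hyperbolic development (Sbierski 2016, Thm. 4 — local existence and local geometric
uniqueness for the vacuum Einstein equations, Choquet-Bruhat 1952; the PDE input); (ii) the
maximal common globally hyperbolic development of any two of them (Thm. 10,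
`CauchyDevelopment.isCommonDevelopment_mcghd`) has no corresponding boundary points (Thm. 17,
whose printed proof via Thm. 12 uses Thm. 4 once more together with the causal theory of §3.2);
(iii) the future unit normal of each development is differentiable along its data embedding
(true for all developments; displayed until proved in the tree). Then any two vacuum Cauchy
developments of `D` embed into a common one — by gluing along the MCGHD
(`VacuumCauchyDevelopment.exists_common_extension`). [cite: Sbierski2016AHP, §3.3, proof of Thm. 5, with Thm. 10 and Thm. 17 (arXiv numbering)] -/
theorem choquetBruhat_geroch_common_extension_of_localTheory_of_mcghd_noCorrespondingBoundary
    (hlocal : ∀ 𝒟 𝒟' : VacuumCauchyDevelopment.{u} D,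
      ∃ U : Opens 𝒟.carrier, 𝒟.toCauchyDevelopment.IsCommonDevelopment 𝒟'.toDataEmbedding U)
    (h17 : ∀ (𝒟 𝒟' : VacuumCauchyDevelopment.{u} D)
      (hne : ∃ U : Opens 𝒟.carrier, 𝒟.toCauchyDevelopment.IsCommonDevelopment 𝒟'.toDataEmbedding U),
      ¬ (CauchyDevelopment.CommonDevelopment.ofIsCommonDevelopment
        (𝒟.toCauchyDevelopment.isCommonDevelopment_mcghd hne)).HasCorrespondingBoundaryPoints)
    (hν : ∀ (𝒟 : VacuumCauchyDevelopment.{u} D) (x : X), MDifferentiableAt (𝓡 n) (𝓡 (n + 1)).tangent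
      (fun x ↦ (TotalSpace.mk' (EuclideanSpace ℝ (Fin (n + 1))) (𝒟.embed x) (𝒟.normal x) :
        TangentBundle (𝓡 (n + 1)) 𝒟.carrier)) x) :
    ∀ 𝒟₁ 𝒟₂ : VacuumCauchyDevelopment.{u} D, ∃ 𝒟₃ : VacuumCauchyDevelopment.{u} D,
      𝒟₁.toCauchyDevelopment.EmbedsInto 𝒟₃.toCauchyDevelopment ∧
        𝒟₂.toCauchyDevelopment.EmbedsInto 𝒟₃.toCauchyDevelopment :=
  fun 𝒟₁ 𝒟₂ ↦ VacuumCauchyDevelopment.exists_common_extension 𝒟₁ 𝒟₂ _ (h17 𝒟₁ 𝒟₂ (hlocal 𝒟₁ 𝒟₂))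
    (hν 𝒟₁)

end Developments

end Literature.Geometry.Lorentzian

end
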